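import Literature.Computability.Complexity.Transducers
import Literature.Computability.Complexity.PairingMachines
import HarnessLib

/-!
# The projections of the pairing `boolPair` are polynomial time (proofs; trunk CplxCore)

Discharge (D-0014) of the three "sanity" named facts of `BoolEncodings.lean` about the
self-delimiting pairing `⟨x, y⟩ = boolPair x y` (Arora–Barak 2009, §0.1, §1.2):

* `polyTimeComputable_boolPair_holds` — `(x, y) ↦ ⟨x, y⟩` w.r.t. the pair encoding is computed by
  the identity machine (`PolyTimeComputable.id`);
* `polyTimeComputable_fst_holds`, `polyTimeComputable_snd_holds` — the two projections, computed by
  finite-state transducers (`Transducers.lean`, `FST.polyTimeComputable_eval`): `UnpairFst.fst`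
  halves the doubled prefix up to the first unequal pair, `UnpairSnd.snd` skips to the separator
  `01` and copies the rest (junk `10` yields `[]`), i.e. they compute the two components of the
  total decoder `boolUnpair` on **every** string (`UnpairFst.eval_eq`, `UnpairSnd.eval_eq`).

Also exported in `FP` form: `boolUnpairFst_mem_FP : (z ↦ (boolUnpair z).1) ∈ FP` and
`boolUnpairSnd_mem_FP : (z ↦ (boolUnpair z).2) ∈ FP` (used for the closure of the counting
hierarchy under the projection, `CountingHierarchyProofs.lean`). Compare `PairingMachines.lean`,
where the normaliser `z ↦ ⟨(boolUnpair z).1, (boolUnpair z).2⟩` is compiled into a machine by hand.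

## References

* S. Arora, B. Barak, *Computational Complexity: A Modern Approach*, CUP 2009, §0.1 (pairing of
  strings), §1.2–1.3.
-/

namespace Literature.Computability.Complexity

open _root_.Computability

/-! ### First projection -/

namespace UnpairFst

/-- States of the first-projection transducer: pair reader (`ev`, `od b`) and the absorbing state
after the first component has ended. [folklore] -/
inductive S
  | ev
  | od (b : Bool)
  | dead
  deriving DecidableEq, Fintype

/-- Transition function: an equal pair `bb` emits `b`; anything else ends the output. [folklore] -/
def step : S → Bool → S × List Bool
  | .ev, b => (.od b, [])
  | .od b, b' => if b = b' then (.ev, [b]) else (.dead, [])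
  | .dead, _ => (.dead, [])

/-- The transducer computing `z ↦ (boolUnpair z).1`. [Arora–Barak 2009, §0.1] [cite: AroraBarak2009, §0.1] -/
def fst : FST S Bool Bool where
  init := .ev
  step := step
  front := fun _ => []
  keep := fun _ => true

/-- The transition of `fst` is `step` (definitional). [folklore] -/
@[simp] theorem fst_step (s : S) (b : Bool) : fst.step s b = step s b := rfl

/-- The absorbing state emits nothing. [folklore] -/
theorem run_dead (w : List Bool) : (fst.run .dead w).2 = [] := by
  induction w with
  | nil => rfl
  | cons b w ih => simp [FST.run_cons, step, ih]

/-- From the initial state the transducer emits `(boolUnpair w).1`. [Arora–Barak 2009, §0.1] [cite: AroraBarak2009, §0.1] -/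
theorem run_ev : ∀ w : List Bool, (fst.run .ev w).2 = (boolUnpair w).1
  | [] => rfl
  | [b] => by simp [FST.run_cons, step, boolUnpair]
  | b :: b' :: w => by
    by_cases h : b = b'
    · subst h
      simp [FST.run_cons, step, PairFstTM.boolUnpair_fst_cons_cons, run_ev w]
    · simp [FST.run_cons, step, PairFstTM.boolUnpair_fst_cons_cons, h, run_dead]

/-- `fst.eval z = (boolUnpair z).1` on every string `z`. [Arora–Barak 2009, §0.1] [cite: AroraBarak2009, §0.1] -/
theorem eval_eq (w : List Bool) : fst.eval w = (boolUnpair w).1 := by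
  have h : fst.eval w = (fst.run .ev w).2 := by simp [FST.eval, fst]
  rw [h, run_ev]

end UnpairFst

/-- **The first projection `z ↦ (boolUnpair z).1` is in `FP`** (a finite-state transduction).
[Arora–Barak 2009, §0.1, §1.3] [cite: AroraBarak2009, §0.1] -/
theorem boolUnpairFst_mem_FP : (fun z => (boolUnpair z).1) ∈ FP := by
  have h : (fun z => (boolUnpair z).1) = UnpairFst.fst.eval :=
    funext fun z => (UnpairFst.eval_eq z).symm
  rw [h]
  exact UnpairFst.fst.polyTimeComputable_eval

/-! ### Second projection -/

namespace UnpairSnd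

/-- States of the second-projection transducer: pair reader (`ev`, `od b`), the copier after the
separator `01`, and the absorbing state after the junk pair `10`. [folklore] -/
inductive S
  | ev
  | od (b : Bool)
  | copy
  | dead
  deriving DecidableEq, Fintype

/-- Transition function: equal pairs are skipped, `01` starts copying, `10` kills. [folklore] -/
def step : S → Bool → S × List Bool
  | .ev, b => (.od b, [])
  | .od b, b' => if b = b' then (.ev, []) else if b' then (.copy, []) else (.dead, [])
  | .copy, b => (.copy, [b])
  | .dead, _ => (.dead, [])

/-- The transducer computing `z ↦ (boolUnpair z).2`. [Arora–Barak 2009, §0.1] [cite: AroraBarak2009, §0.1] -/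
def snd : FST S Bool Bool where
  init := .ev
  step := step
  front := fun _ => []
  keep := fun _ => true

/-- The transition of `snd` is `step` (definitional). [folklore] -/
@[simp] theorem snd_step (s : S) (b : Bool) : snd.step s b = step s b := rfl

/-- The copier copies. [folklore] -/
theorem run_copy (w : List Bool) : (snd.run .copy w).2 = w := by
  induction w with
  | nil => rfl
  | cons b w ih => simp [FST.run_cons, step, ih]

/-- The absorbing state emits nothing. [folklore] -/
theorem run_dead (w : List Bool) : (snd.run .dead w).2 = [] := by
  induction w with
  | nil => rfl
  | cons b w ih => simp [FST.run_cons, step, ih]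

/-- From the initial state the transducer emits `(boolUnpair w).2`. [Arora–Barak 2009, §0.1] [cite: AroraBarak2009, §0.1] -/
theorem run_ev : ∀ w : List Bool, (snd.run .ev w).2 = (boolUnpair w).2
  | [] => rfl
  | [b] => by simp [FST.run_cons, step]
  | b :: b' :: w => by
    by_cases h : b = b'
    · subst h
      simp [FST.run_cons, step, boolUnpair_snd_cons_cons, run_ev w]
    · cases b'
      · simp [FST.run_cons, step, boolUnpair_snd_cons_cons, h, run_dead]
      · simp [FST.run_cons, step, boolUnpair_snd_cons_cons, h, run_copy]

/-- `snd.eval z = (boolUnpair z).2` on every string `z`. [Arora–Barak 2009, §0.1] [cite: AroraBarak2009, §0.1] -/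
theorem eval_eq (w : List Bool) : snd.eval w = (boolUnpair w).2 := by
  have h : snd.eval w = (snd.run .ev w).2 := by simp [FST.eval, snd]
  rw [h, run_ev]

end UnpairSnd

/-- **The second projection `z ↦ (boolUnpair z).2` is in `FP`** (a finite-state transduction).
[Arora–Barak 2009, §0.1, §1.3] [cite: AroraBarak2009, §0.1] -/
theorem boolUnpairSnd_mem_FP : (fun z => (boolUnpair z).2) ∈ FP := by
  have h : (fun z => (boolUnpair z).2) = UnpairSnd.snd.eval :=
    funext fun z => (UnpairSnd.eval_eq z).symm
  rw [h]
  exact UnpairSnd.snd.polyTimeComputable_eval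

/-! ### Discharge of the three named facts of `BoolEncodings.lean` -/

/-- **Discharge of `polyTimeComputable_boolPair`**: on the pair encoding
`(x, y) ↦ boolPair x y` the pairing map is computed by the identity machine. [Arora–Barak 2009,
§1.2] [cite: AroraBarak2009, §1.2] -/
theorem polyTimeComputable_boolPair_holds : polyTimeComputable_boolPair := by
  obtain ⟨p, M, hM⟩ := PolyTimeComputable.id (id : List Bool → List Bool)
  exact ⟨p, M, fun q => hM (boolPair q.1 q.2)⟩

/-- **Discharge of `polyTimeComputable_fst`** (transport of `boolUnpairFst_mem_FP` along
`boolUnpair_boolPair`). [Arora–Barak 2009, §0.1, §1.2] [cite: AroraBarak2009, §0.1] -/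
theorem polyTimeComputable_fst_holds : polyTimeComputable_fst := by
  obtain ⟨p, M, hM⟩ := boolUnpairFst_mem_FP
  refine ⟨p, M, fun q => ?_⟩
  have h := hM (boolPair q.1 q.2)
  simp only [id, boolUnpair_boolPair] at h
  exact h

/-- **Discharge of `polyTimeComputable_snd`** (transport of `boolUnpairSnd_mem_FP` along
`boolUnpair_boolPair`). [Arora–Barak 2009, §0.1, §1.2] [cite: AroraBarak2009, §0.1] -/
theorem polyTimeComputable_snd_holds : polyTimeComputable_snd := by
  obtain ⟨p, M, hM⟩ := boolUnpairSnd_mem_FP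
  refine ⟨p, M, fun q => ?_⟩
  have h := hM (boolPair q.1 q.2)
  simp only [id, boolUnpair_boolPair] at h
  exact h

end Literature.Computability.Complexity
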